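import Summits.CriticalPhenomena.PercolationContinuityZ3.Theorems.Transplant.DiamondSkeletonConc
import Summits.CriticalPhenomena.PercolationContinuityZ3.Theorems.Transplant.SkelConcHolds
import HarnessLib

/-!
# The DIAMOND lattice at its own critical point — UNCONDITIONAL: `θ_{diamond}(p_c(diamond)) = 0` at every vertex, and a.s. no infinite
# cluster at `p_c(diamond)`

builds on p205010 (kernel theorem, internal audit signed; external expert review pending).
Status sentence (coordinator 2026-08-20T04:30Z): "θ(p_c) = 0 on ℤ^d, all d ≥ 2 — kernel-verified (Lean 4/Mathlib,
standard axioms); internal adversarial audit SIGNED 2026-08-20 04:29Z; external expert review pending."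

Lane `prim-bschramm-*`, seat `prim-bschramm-p2` (gen 6; class C1b row F).  One-liners: the reduction `diamondOwnCriticalContinuity_of_skeletonConcNode`
(`DiamondSkeletonConc.lean`) composed with the lane's general node `samePDropOfSkeletonConcLt_holds` (`SkelConcHolds.lean`, the (Z') closure of the
design-(D) re-typing of Kozma–Nitzan §4 over planar skeletons; builds on p205010).  Bond percolation on the diamond lattice (Conway–Sloane `D₃⁺`, the
diamond / zincblende net) has NO infinite cluster at its own critical point.  Not in print (numerically `p_c^{bond}(diamond) ≈ 0.389`, not used).
[cite: BenjaminiSchramm1996, Conj. 4] [cite: ConwaySloane1999, Ch. 4 §7.3 (D₃⁺ = diamond)] [cite: KozmaNitzan2024, §1 p. 2 (approach 1), §4]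
-/

noncomputable section

namespace Summit.CriticalPhenomena.PercolationContinuityZ3.Theorems.Transplant

open MeasureTheory Literature.Probability.Percolation Literature.Probability.LatticeModels

/-- **THEOREM: bond percolation on the diamond lattice dies at its own critical point**, `θ_{diamond}(p_c(diamond)) = 0` at the origin — builds on
p205010 (kernel theorem, internal audit signed; external expert review pending). [cite: BenjaminiSchramm1996, Conj. 4] [cite: ConwaySloane1999, Ch. 4 §7.3] -/
theorem diamondOwnCriticalContinuity_holds : DiamondOwnCriticalContinuity :=
  diamondOwnCriticalContinuity_of_skeletonConcNode samePDropOfSkeletonConcLt_holds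

/-- … at EVERY vertex of the diamond lattice. [cite: BenjaminiSchramm1996, Conj. 4] -/
theorem diamond_criticalContinuity_holds (v : diamondSite) : theta diamondGraph v (criticalProbIOf diamondGraph v) = 0 :=
  diamond_criticalContinuity_of_skeletonConcNode samePDropOfSkeletonConcLt_holds v

/-- **At `p_c(diamond)` there is almost surely no infinite cluster anywhere in the diamond lattice.** [cite: BenjaminiSchramm1996, Conj. 4] -/
theorem diamond_noInfiniteCluster_at_ownCriticalProb :
    (bondPercolation diamondGraph (criticalProbIOf diamondGraph diamondOrigin)).real {ω | ∃ y : diamondSite, ω ∈ percolatesAt y} = 0 :=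
  diamond_noInfiniteCluster_of_skeletonConcNode samePDropOfSkeletonConcLt_holds

end Summit.CriticalPhenomena.PercolationContinuityZ3.Theorems.Transplant

end
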